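/-
Copyright (c) 2026 the pub-hodgecm-mathlib formalisation cell (harness21).  Prover seat hodgecm-mathlib-LH5-p04 (g10), 2026-09-03.  E1 row 56-B1 (file 2 of 2) «(U7)-RAM: GEODESIC
INCLUSION FOR ANY ISOMETRIC INVOLUTION ∕ AT A TAME RAMIFIED PLACE» (E1 keeper ∕ dealer F0P3a-p03 (g30) 03:19:57Z; LEAD F0P3a-plan (g16) T15-42 03:22:05Z «TAME RE-OPENS as a GO-LOW
ROAD; WILD = PRINT»; rule 20).  Twin of the two datum heads of ★ row 41-U7 `UnitaryLatticeTreeGeodesicInclusion` (LH6-p04 (g11)) over the sibling ★ `…GeodesicApartmentOfInvolution`.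
-/
import Literature.NumberTheory.Automorphic.UnitaryLatticeTreeGeodesicApartmentOfInvolution  -- ★ row 56-B1 file 1 (LH5-p04 (g10)): `exists_apartmentEnum_of_involution`, `exists_latticeGraphIso_apartmentEnum_{pair,geodesic,of_adj_of_dist}_of_involution` (hypothesis-style `hT hfr htr₂`)
import Literature.NumberTheory.Automorphic.UnitaryLatticeTreeGeodesicInclusion             -- ★ row 41-U7 (LH6-p04 (g11)): place-free `unitaryLevel_subset_mul_of_apartment_witness(_subtype)`, `coe_apartmentEnum_eq_latt_diagonal_floor`
import Literature.NumberTheory.Automorphic.UnitaryLatticeTreeFramesOfInvolution            -- ★ (B-p14 (g36)): `isTree_latticeGraph_three_of_neg`, `exists_frame_mapGL_stdLattice` (Cartan `K t_a K` of ANY involution, read on lattices); brings ★ `…SelfDualTransitiveTame`, ★ `…TypeTwoTransitiveRamified`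
import HarnessLib

/-!
# The lattice tree of `U(3)`: (U7) GEODESIC INCLUSION `U_y ⊆ U_x · U_z` FOR ANY ISOMETRIC INVOLUTION (hypothesis-style), AND UNCONDITIONALLY AT A TAME RAMIFIED PLACE
# (Schneider–Stuhler 1997 Prop. I.3.1; Bruhat–Tits 1972 (7.4.18), §10; Tits 1979 §2.4, §3.3.3; Serre, *Trees* I.2.2)

Topic `NumberTheory/Automorphic`; namespace `Literature.NumberTheory.Automorphic.UnitaryLatticeTree`.  THEOREMS ONLY (no definition, no instance, no notation, no named fact, no
`sorry`).  Cell `pub/hodgecm-mathlib` (D-0151), crux H413 = `stmt-HodgeConjecture-24833`; E1 row 56-B1, file 2 of 2 (census R56 `F0/P3c/LH5/LH5-p04/g10/r56/CENSUS-R56-ramified-tree.v1.md`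
brick B1).  HONEST LABEL: count-neutral lattice-model layer of the GO-LOW TAME road (LEAD T15-42); WILD `v ∣ 2` stays PRINT of record; h413 OPEN; HC_CM is proved only modulo the 2
remaining named inputs (hLiu418 24832, h413 24833) until rung 0 closes; nothing printed is asserted here.

CONTENT.  ★ row 41-U7 proves the (U7) head `unitaryLevel_subset_mul_of_adj_of_dist(_subtype)` from the datum `hd : UnramifiedLocalConjDatum σ ϖ` through exactly two datum
inputs — ★ `exists_apartmentEnum hd` and ★ `exists_latticeGraphIso_apartmentEnum_of_adj_of_dist hd` — the factorisation ★ `unitaryLevel_subset_mul_of_apartment_witness(_subtype)`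
being place-free (`hϖ` only).  File 1 supplies both inputs for ANY isometric involution, hypothesis-style over the tree `hT`, the self-dual frames `hfr` and the type-`2`
transitivity `htr₂`; §1 here is the (U7) head in that currency (`…_of_involution`, conclusions VERBATIM ★ row 41-U7's), and §2 DISCHARGES `hT hfr htr₂` at a TAME RAMIFIED place
(`σϖ = −ϖ`, `hres : v(σx − x) < 1` on `𝒪`, `|2| = 1`, `hnorm` — the block of ★ `ramifiedBlock_adicCompletion`): frames by self-dual transitivity ★
`exists_unitary_mapGL_stdLattice_eq_of_isSelfDualLattice_of_v_two` + the Cartan decomposition of any involution read on lattices ★ `exists_frame_mapGL_stdLattice` (the two-sided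
`K t_a K` shape — the census caveat is void), tree ★ `isTree_latticeGraph_three_of_neg`, type-`2` transitivity ★ `forall_isVertexLattice_two_exists_mapGL_N₁_eq_of_neg`; whence the
`_of_neg` heads (token pass `hd ↦ hσ hvσ hϖ hσϖ hres h2 hnorm` for every consumer twin, B2 = 41g-RAM first).

* §1 `unitaryLevel_subset_mul_of_adj_of_dist_of_involution`, `unitaryLevel_subset_mul_of_adj_of_dist_subtype_of_involution` (hypothesis-style `hT hfr htr₂`).
* §2 (tame, `[ValuativeRel K] [Valued.v.Compatible]`): `exists_frame_three_of_isSelfDualLattice_of_neg`; **`exists_latticeGraphIso_apartmentEnum_pair_of_neg`**,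
  **`exists_latticeGraphIso_apartmentEnum_geodesic_of_neg`**, **`exists_latticeGraphIso_apartmentEnum_of_adj_of_dist_of_neg`**; **`unitaryLevel_subset_mul_of_adj_of_dist_of_neg`**,
  **`unitaryLevel_subset_mul_of_adj_of_dist_subtype_of_neg`** (row 34's `hU7` shape at a tame ramified place).

## References
* [SchneiderStuhler1997] P. Schneider, U. Stuhler, *Representation theory and sheaves on the Bruhat–Tits building*, Publ. Math. IHÉS 85 (1997), Ch. I Prop. I.3.1 p. 118 (U7).
* [BruhatTits1972] F. Bruhat, J. Tits, *Groupes réductifs sur un corps local I*, Publ. Math. IHÉS 41 (1972), (7.4.18), (4.4.3), §10.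
* [Tits1979] J. Tits, *Reductive groups over local fields*, PSPM 33.1 (1979), §2.4 (ramified `²A₂`), §3.3.3.
* [Serre1980Trees] J.-P. Serre, *Trees* (1980), Ch. I §2.2 Prop. 8, Ch. II §1.1.
* [Korman2004] J. Korman, *On the local constancy of characters*, J. Inst. Math. Jussieu 4 (2005), §3.6 (U7).
-/

set_option autoImplicit false

open scoped Valued WithZero Matrix MatrixGroups Pointwise

namespace Literature.NumberTheory.Automorphic.UnitaryLatticeTree

open _root_.SimpleGraph Literature.NumberTheory.Automorphic Literature.NumberTheory.Automorphic.HermitianLattice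

variable {K : Type*} [Field K] [Valued K ℤᵐ⁰] {σ : K →+* K} {ϖ : K}

/-! ## §1 (U7) geodesic inclusion for any isometric involution — hypothesis-style (`hT`, `hfr`, `htr₂`) -/

section Involution

variable (hσ : ∀ x, σ (σ x) = x) (hvσ : ∀ a, Valued.v (σ a) = Valued.v a) (hϖ : Valued.v ϖ = WithZero.exp (-1 : ℤ))
  (hT : (latticeGraph σ ϖ ((StdForm.antidiagonal 3).over K)).IsTree)
  (hfr : ∀ M : Submodule 𝒪[K] (Fin 3 → K), IsSelfDualLattice σ ϖ ((StdForm.antidiagonal 3).over K) M →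
    ∃ k : unitaryGroupOfForm σ ((StdForm.antidiagonal 3).over K), k ∈ unitaryInt σ ((StdForm.antidiagonal 3).over K) ∧
      ∃ a : ℤ, M = mapGL (k : GL (Fin 3) K) (latt (Matrix.diagonal ![ϖ ^ a, 1, ϖ ^ (-a)])))
  (htr₂ : ∀ M : Submodule 𝒪[K] (Fin 3 → K), IsVertexLattice σ ϖ ((StdForm.antidiagonal 3).over K) 2 M →
    ∃ u : unitaryGroupOfForm σ ((StdForm.antidiagonal 3).over K), M = mapGL (u : GL (Fin 3) K) (latt (Matrix.diagonal ![(1 : K), 1, ϖ])))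
include hσ hvσ hϖ hT hfr htr₂

/-- **(U7) GEODESIC INCLUSION FOR ANY ISOMETRIC INVOLUTION** ([SS97] Prop. I.3.1 for the lattice graph of `U(Φ₃)(K)`, hypothesis-style over the tree `hT`, the self-dual frames
`hfr` and type-two transitivity `htr₂`): with `U x` the unitary level group of the vertex `x` at level `c` (`0 < |c| < 1`, hypothesis-style `hU`), if `x ~ y` and `y` is the
first step of the geodesic from `x` to `z`, then `U_y ⊆ U_x · U_z` — ★ `unitaryLevel_subset_mul_of_adj_of_dist`'s conclusion VERBATIM.
[cite: SchneiderStuhler1997, Ch. I Prop. I.3.1 p. 118] [cite: Korman2004, §3.6] [cite: BruhatTits1972, (7.4.18)] -/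
theorem unitaryLevel_subset_mul_of_adj_of_dist_of_involution {c : K} (hc0 : c ≠ 0) (hc1 : Valued.v c < 1)
    (U : {M : Submodule 𝒪[K] (Fin 3 → K) // IsVertex σ ϖ ((StdForm.antidiagonal 3).over K) M} → Subgroup (GL (Fin 3) K))
    (hU : ∀ (x : {M : Submodule 𝒪[K] (Fin 3 → K) // IsVertex σ ϖ ((StdForm.antidiagonal 3).over K) M}) (g : GL (Fin 3) K),
      g ∈ U x ↔ g ∈ unitaryGroupOfForm σ ((StdForm.antidiagonal 3).over K) ∧ mapGL g x.1 = x.1 ∧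
        x.1.map ((Matrix.toLin' ((g : Matrix (Fin 3) (Fin 3) K) - 1)).restrictScalars 𝒪[K]) ≤ scaleLattice c x.1)
    {x y z : {M : Submodule 𝒪[K] (Fin 3 → K) // IsVertex σ ϖ ((StdForm.antidiagonal 3).over K) M}}
    (hxy : (latticeGraph σ ϖ ((StdForm.antidiagonal 3).over K)).Adj x y)
    (hyz : (latticeGraph σ ϖ ((StdForm.antidiagonal 3).over K)).dist y z + 1 = (latticeGraph σ ϖ ((StdForm.antidiagonal 3).over K)).dist x z) :
    (U y : Set (GL (Fin 3) K)) ⊆ (U x : Set (GL (Fin 3) K)) * (U z : Set (GL (Fin 3) K)) := by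
  obtain ⟨A, hA0, hA1⟩ := exists_apartmentEnum_of_involution hσ hvσ hϖ
  obtain ⟨u, i, k, hik, hx, hy, hz⟩ := exists_latticeGraphIso_apartmentEnum_of_adj_of_dist_of_involution hσ hvσ hϖ A hA0 hA1 hT hfr htr₂ hxy hyz
  refine unitaryLevel_subset_mul_of_apartment_witness σ hϖ hc0 hc1 U hU u.2 (i := i) (j := i + 1) (k := k) (Or.inl ⟨by omega, hik⟩) ?_ ?_ ?_
  · rw [hx, ← coe_apartmentEnum_eq_latt_diagonal_floor σ A hA0 hA1]; rfl
  · rw [hy, ← coe_apartmentEnum_eq_latt_diagonal_floor σ A hA0 hA1]; rfl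
  · rw [hz, ← coe_apartmentEnum_eq_latt_diagonal_floor σ A hA0 hA1]; rfl

/-- **(U7) GEODESIC INCLUSION FOR ANY ISOMETRIC INVOLUTION — SUBTYPE FORM** (`Γ = ↥U(σ, J)`, `J = Φ₃` as `hJ`; row 34's `hU7` shape), hypothesis-style over `hT hfr htr₂` —
★ `unitaryLevel_subset_mul_of_adj_of_dist_subtype`'s conclusion VERBATIM. [cite: SchneiderStuhler1997, Ch. I Prop. I.3.1 p. 118] [cite: Korman2004, §3.6] [cite: BruhatTits1972, (7.4.18)] -/
theorem unitaryLevel_subset_mul_of_adj_of_dist_subtype_of_involution {c : K} (hc0 : c ≠ 0) (hc1 : Valued.v c < 1)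
    {J : Matrix (Fin 3) (Fin 3) K} (hJ : J = (StdForm.antidiagonal 3).over K)
    (U : {M : Submodule 𝒪[K] (Fin 3 → K) // IsVertex σ ϖ J M} → Subgroup ↥(unitaryGroupOfForm σ J))
    (hU : ∀ (x : {M : Submodule 𝒪[K] (Fin 3 → K) // IsVertex σ ϖ J M}) (γ : ↥(unitaryGroupOfForm σ J)),
      γ ∈ U x ↔ mapGL (γ : GL (Fin 3) K) x.1 = x.1 ∧ x.1.map ((Matrix.toLin' (((γ : GL (Fin 3) K) : Matrix (Fin 3) (Fin 3) K) - 1)).restrictScalars 𝒪[K]) ≤ scaleLattice c x.1)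
    {x y z : {M : Submodule 𝒪[K] (Fin 3 → K) // IsVertex σ ϖ J M}}
    (hxy : (latticeGraph σ ϖ J).Adj x y) (hyz : (latticeGraph σ ϖ J).dist y z + 1 = (latticeGraph σ ϖ J).dist x z) :
    (U y : Set ↥(unitaryGroupOfForm σ J)) ⊆ (U x : Set ↥(unitaryGroupOfForm σ J)) * (U z : Set ↥(unitaryGroupOfForm σ J)) := by
  subst hJ
  obtain ⟨A, hA0, hA1⟩ := exists_apartmentEnum_of_involution hσ hvσ hϖ
  obtain ⟨u, i, k, hik, hx, hy, hz⟩ := exists_latticeGraphIso_apartmentEnum_of_adj_of_dist_of_involution hσ hvσ hϖ A hA0 hA1 hT hfr htr₂ hxy hyz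
  refine unitaryLevel_subset_mul_of_apartment_witness_subtype σ hϖ hc0 hc1 rfl U hU u (i := i) (j := i + 1) (k := k) (Or.inl ⟨by omega, hik⟩) ?_ ?_ ?_
  · rw [hx, ← coe_apartmentEnum_eq_latt_diagonal_floor σ A hA0 hA1]; rfl
  · rw [hy, ← coe_apartmentEnum_eq_latt_diagonal_floor σ A hA0 hA1]; rfl
  · rw [hz, ← coe_apartmentEnum_eq_latt_diagonal_floor σ A hA0 hA1]; rfl

end Involution

/-! ## §2 AT A TAME RAMIFIED PLACE (`σϖ = −ϖ`, `hres`, `|2| = 1`, `hnorm`): the three hypotheses discharged -/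

section Tame

variable [ValuativeRel K] [(Valued.v : Valuation K ℤᵐ⁰).Compatible]

/-- **FRAMES OF A SELF-DUAL VERTEX AT A TAME RAMIFIED PLACE**: every self-dual `M` is `κ · L_a` with `κ ∈ K₀`, `a : ℤ` (self-dual transitivity ★
`exists_unitary_mapGL_stdLattice_eq_of_isSelfDualLattice_of_v_two` + the two-sided Cartan decomposition `K t_a K` of ANY isometric involution read on lattices ★
`exists_frame_mapGL_stdLattice`) — the tame twin of ★ `exists_frame_three_of_isSelfDualLattice`. [cite: BruhatTits1972, (4.4.3), §10] [cite: Tits1979, §3.3.3] -/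
theorem exists_frame_three_of_isSelfDualLattice_of_neg (hσ : ∀ x, σ (σ x) = x) (hvσ : ∀ a, Valued.v (σ a) = Valued.v a) (hϖ : Valued.v ϖ = WithZero.exp (-1 : ℤ))
    (h2 : Valued.v (2 : K) = 1) (M : Submodule 𝒪[K] (Fin 3 → K)) (hM : IsSelfDualLattice σ ϖ ((StdForm.antidiagonal 3).over K) M) :
    ∃ k : unitaryGroupOfForm σ ((StdForm.antidiagonal 3).over K), k ∈ unitaryInt σ ((StdForm.antidiagonal 3).over K) ∧
      ∃ a : ℤ, M = mapGL (k : GL (Fin 3) K) (latt (Matrix.diagonal ![ϖ ^ a, 1, ϖ ^ (-a)])) := by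
  obtain ⟨u, hu⟩ := exists_unitary_mapGL_stdLattice_eq_of_isSelfDualLattice_of_v_two hσ hvσ hϖ h2 hM
  obtain ⟨κ, hκ, a, ha⟩ := exists_frame_mapGL_stdLattice hσ hvσ hϖ u
  exact ⟨κ, hκ, a, by rw [hu, ha]⟩

variable (hσ : ∀ x, σ (σ x) = x) (hvσ : ∀ a, Valued.v (σ a) = Valued.v a) (hϖ : Valued.v ϖ = WithZero.exp (-1 : ℤ)) (hσϖ : σ ϖ = -ϖ)
  (hres : ∀ x : K, Valued.v x ≤ 1 → Valued.v (σ x - x) < 1) (h2 : Valued.v (2 : K) = 1)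
  (hnorm : ∀ u : K, σ u = u → Valued.v (u - 1) < 1 → ∃ z : K, z * σ z = u ∧ Valued.v (z - 1) ≤ Valued.v (u - 1))
include hσ hvσ hϖ hσϖ hres h2 hnorm

/-- **ANY TWO VERTICES OF THE TAME-RAMIFIED `U(3)` TREE LIE IN ONE TRANSLATE OF THE STANDARD APARTMENT**: `x = u·A i`, `z = u·A k`, `i ≤ k` — ★ row 39γ's
`exists_latticeGraphIso_apartmentEnum_pair` at `σϖ = −ϖ`, `|2| = 1`. [cite: BruhatTits1972, (7.4.18), §10] [cite: Tits1979, §2.4] [cite: Serre1980Trees, I.2.2, II.1.1] -/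
theorem exists_latticeGraphIso_apartmentEnum_pair_of_neg
    (A : ℤ → {M : Submodule 𝒪[K] (Fin 3 → K) // IsVertex σ ϖ ((StdForm.antidiagonal 3).over K) M})
    (hA0 : ∀ a : ℤ, (A (2 * a)).1 = latt (Matrix.diagonal ![ϖ ^ a, (1 : K), ϖ ^ (-a)]))
    (hA1 : ∀ a : ℤ, (A (2 * a + 1)).1 = latt (Matrix.diagonal ![ϖ ^ (a + 1), (1 : K), ϖ ^ (-a)]))
    (x z : {M : Submodule 𝒪[K] (Fin 3 → K) // IsVertex σ ϖ ((StdForm.antidiagonal 3).over K) M}) :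
    ∃ u : unitaryGroupOfForm σ ((StdForm.antidiagonal 3).over K), ∃ i k : ℤ, i ≤ k ∧
      x = latticeGraphIso σ ϖ ((StdForm.antidiagonal 3).over K) u (A i) ∧ z = latticeGraphIso σ ϖ ((StdForm.antidiagonal 3).over K) u (A k) :=
  exists_latticeGraphIso_apartmentEnum_pair_of_involution hσ hvσ hϖ A hA0 hA1 (isTree_latticeGraph_three_of_neg hσ hvσ hϖ hσϖ hres h2 hnorm)
    (exists_frame_three_of_isSelfDualLattice_of_neg hσ hvσ hϖ h2) (forall_isVertexLattice_two_exists_mapGL_N₁_eq_of_neg hσ hvσ hϖ hσϖ hres h2 hnorm) x z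

/-- **THE GEODESIC BETWEEN TWO VERTICES OF THE TAME-RAMIFIED TREE LIES IN ONE APARTMENT TRANSLATE** (`dist x z = k − i`; every `w ∈ [x, z]` is `u·A j`, `i ≤ j ≤ k`).
[cite: BruhatTits1972, (7.4.18), §10] [cite: Tits1979, §2.4] [cite: Serre1980Trees, I.2.2 Prop. 8] -/
theorem exists_latticeGraphIso_apartmentEnum_geodesic_of_neg
    (A : ℤ → {M : Submodule 𝒪[K] (Fin 3 → K) // IsVertex σ ϖ ((StdForm.antidiagonal 3).over K) M})
    (hA0 : ∀ a : ℤ, (A (2 * a)).1 = latt (Matrix.diagonal ![ϖ ^ a, (1 : K), ϖ ^ (-a)]))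
    (hA1 : ∀ a : ℤ, (A (2 * a + 1)).1 = latt (Matrix.diagonal ![ϖ ^ (a + 1), (1 : K), ϖ ^ (-a)]))
    (x z : {M : Submodule 𝒪[K] (Fin 3 → K) // IsVertex σ ϖ ((StdForm.antidiagonal 3).over K) M}) :
    ∃ u : unitaryGroupOfForm σ ((StdForm.antidiagonal 3).over K), ∃ i k : ℤ, i ≤ k ∧
      x = latticeGraphIso σ ϖ ((StdForm.antidiagonal 3).over K) u (A i) ∧ z = latticeGraphIso σ ϖ ((StdForm.antidiagonal 3).over K) u (A k) ∧
      ((latticeGraph σ ϖ ((StdForm.antidiagonal 3).over K)).dist x z : ℤ) = k - i ∧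
      ∀ w, (latticeGraph σ ϖ ((StdForm.antidiagonal 3).over K)).dist x w + (latticeGraph σ ϖ ((StdForm.antidiagonal 3).over K)).dist w z =
          (latticeGraph σ ϖ ((StdForm.antidiagonal 3).over K)).dist x z →
        ∃ j : ℤ, i ≤ j ∧ j ≤ k ∧ w = latticeGraphIso σ ϖ ((StdForm.antidiagonal 3).over K) u (A j) :=
  exists_latticeGraphIso_apartmentEnum_geodesic_of_involution hσ hvσ hϖ A hA0 hA1 (isTree_latticeGraph_three_of_neg hσ hvσ hϖ hσϖ hres h2 hnorm)
    (exists_frame_three_of_isSelfDualLattice_of_neg hσ hvσ hϖ h2) (forall_isVertexLattice_two_exists_mapGL_N₁_eq_of_neg hσ hvσ hϖ hσϖ hres h2 hnorm) x z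

/-- **THE (U7) ANTECEDENT AT A TAME RAMIFIED PLACE**: `x ~ y`, `dist y z + 1 = dist x z` ⇒ `(x, y, z) = u·(A i, A (i+1), A k)` with `i + 1 ≤ k`.
[cite: SchneiderStuhler1997, Prop. I.3.1 p. 118] [cite: BruhatTits1972, (7.4.18), §10] [cite: Tits1979, §2.4] -/
theorem exists_latticeGraphIso_apartmentEnum_of_adj_of_dist_of_neg
    (A : ℤ → {M : Submodule 𝒪[K] (Fin 3 → K) // IsVertex σ ϖ ((StdForm.antidiagonal 3).over K) M})
    (hA0 : ∀ a : ℤ, (A (2 * a)).1 = latt (Matrix.diagonal ![ϖ ^ a, (1 : K), ϖ ^ (-a)]))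
    (hA1 : ∀ a : ℤ, (A (2 * a + 1)).1 = latt (Matrix.diagonal ![ϖ ^ (a + 1), (1 : K), ϖ ^ (-a)]))
    {x y z : {M : Submodule 𝒪[K] (Fin 3 → K) // IsVertex σ ϖ ((StdForm.antidiagonal 3).over K) M}}
    (hxy : (latticeGraph σ ϖ ((StdForm.antidiagonal 3).over K)).Adj x y)
    (hyz : (latticeGraph σ ϖ ((StdForm.antidiagonal 3).over K)).dist y z + 1 = (latticeGraph σ ϖ ((StdForm.antidiagonal 3).over K)).dist x z) :
    ∃ u : unitaryGroupOfForm σ ((StdForm.antidiagonal 3).over K), ∃ i k : ℤ, i + 1 ≤ k ∧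
      x = latticeGraphIso σ ϖ ((StdForm.antidiagonal 3).over K) u (A i) ∧ y = latticeGraphIso σ ϖ ((StdForm.antidiagonal 3).over K) u (A (i + 1)) ∧
      z = latticeGraphIso σ ϖ ((StdForm.antidiagonal 3).over K) u (A k) :=
  exists_latticeGraphIso_apartmentEnum_of_adj_of_dist_of_involution hσ hvσ hϖ A hA0 hA1 (isTree_latticeGraph_three_of_neg hσ hvσ hϖ hσϖ hres h2 hnorm)
    (exists_frame_three_of_isSelfDualLattice_of_neg hσ hvσ hϖ h2) (forall_isVertexLattice_two_exists_mapGL_N₁_eq_of_neg hσ hvσ hϖ hσϖ hres h2 hnorm) hxy hyz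

/-- **(U7) GEODESIC INCLUSION AT A TAME RAMIFIED PLACE** (`σϖ = −ϖ`, `|2| = 1`): `x ~ y`, `dist y z + 1 = dist x z` ⇒ `U_y ⊆ U_x · U_z` — ★ row 41-U7's head with the
datum replaced by the tame letters. [cite: SchneiderStuhler1997, Ch. I Prop. I.3.1 p. 118] [cite: Korman2004, §3.6] [cite: BruhatTits1972, (7.4.18)] [cite: Tits1979, §2.4] -/
theorem unitaryLevel_subset_mul_of_adj_of_dist_of_neg {c : K} (hc0 : c ≠ 0) (hc1 : Valued.v c < 1)
    (U : {M : Submodule 𝒪[K] (Fin 3 → K) // IsVertex σ ϖ ((StdForm.antidiagonal 3).over K) M} → Subgroup (GL (Fin 3) K))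
    (hU : ∀ (x : {M : Submodule 𝒪[K] (Fin 3 → K) // IsVertex σ ϖ ((StdForm.antidiagonal 3).over K) M}) (g : GL (Fin 3) K),
      g ∈ U x ↔ g ∈ unitaryGroupOfForm σ ((StdForm.antidiagonal 3).over K) ∧ mapGL g x.1 = x.1 ∧
        x.1.map ((Matrix.toLin' ((g : Matrix (Fin 3) (Fin 3) K) - 1)).restrictScalars 𝒪[K]) ≤ scaleLattice c x.1)
    {x y z : {M : Submodule 𝒪[K] (Fin 3 → K) // IsVertex σ ϖ ((StdForm.antidiagonal 3).over K) M}}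
    (hxy : (latticeGraph σ ϖ ((StdForm.antidiagonal 3).over K)).Adj x y)
    (hyz : (latticeGraph σ ϖ ((StdForm.antidiagonal 3).over K)).dist y z + 1 = (latticeGraph σ ϖ ((StdForm.antidiagonal 3).over K)).dist x z) :
    (U y : Set (GL (Fin 3) K)) ⊆ (U x : Set (GL (Fin 3) K)) * (U z : Set (GL (Fin 3) K)) :=
  unitaryLevel_subset_mul_of_adj_of_dist_of_involution hσ hvσ hϖ (isTree_latticeGraph_three_of_neg hσ hvσ hϖ hσϖ hres h2 hnorm)
    (exists_frame_three_of_isSelfDualLattice_of_neg hσ hvσ hϖ h2) (forall_isVertexLattice_two_exists_mapGL_N₁_eq_of_neg hσ hvσ hϖ hσϖ hres h2 hnorm) hc0 hc1 U hU hxy hyz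

/-- **(U7) GEODESIC INCLUSION AT A TAME RAMIFIED PLACE — SUBTYPE FORM** (row 34's `hU7` shape, `Γ = ↥U(σ, J)`, `J = Φ₃` as `hJ`).
[cite: SchneiderStuhler1997, Ch. I Prop. I.3.1 p. 118] [cite: Korman2004, §3.6] [cite: BruhatTits1972, (7.4.18)] [cite: Tits1979, §2.4] -/
theorem unitaryLevel_subset_mul_of_adj_of_dist_subtype_of_neg {c : K} (hc0 : c ≠ 0) (hc1 : Valued.v c < 1)
    {J : Matrix (Fin 3) (Fin 3) K} (hJ : J = (StdForm.antidiagonal 3).over K)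
    (U : {M : Submodule 𝒪[K] (Fin 3 → K) // IsVertex σ ϖ J M} → Subgroup ↥(unitaryGroupOfForm σ J))
    (hU : ∀ (x : {M : Submodule 𝒪[K] (Fin 3 → K) // IsVertex σ ϖ J M}) (γ : ↥(unitaryGroupOfForm σ J)),
      γ ∈ U x ↔ mapGL (γ : GL (Fin 3) K) x.1 = x.1 ∧ x.1.map ((Matrix.toLin' (((γ : GL (Fin 3) K) : Matrix (Fin 3) (Fin 3) K) - 1)).restrictScalars 𝒪[K]) ≤ scaleLattice c x.1)
    {x y z : {M : Submodule 𝒪[K] (Fin 3 → K) // IsVertex σ ϖ J M}}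
    (hxy : (latticeGraph σ ϖ J).Adj x y) (hyz : (latticeGraph σ ϖ J).dist y z + 1 = (latticeGraph σ ϖ J).dist x z) :
    (U y : Set ↥(unitaryGroupOfForm σ J)) ⊆ (U x : Set ↥(unitaryGroupOfForm σ J)) * (U z : Set ↥(unitaryGroupOfForm σ J)) := by
  subst hJ
  exact unitaryLevel_subset_mul_of_adj_of_dist_subtype_of_involution hσ hvσ hϖ (isTree_latticeGraph_three_of_neg hσ hvσ hϖ hσϖ hres h2 hnorm)
    (exists_frame_three_of_isSelfDualLattice_of_neg hσ hvσ hϖ h2) (forall_isVertexLattice_two_exists_mapGL_N₁_eq_of_neg hσ hvσ hϖ hσϖ hres h2 hnorm) hc0 hc1 rfl U hU hxy hyz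

end Tame

end Literature.NumberTheory.Automorphic.UnitaryLatticeTree
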